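import Literature.NumberTheory.EllipticCurves.FunctionFieldEllipticLConstantProofs
import Literature.NumberTheory.EllipticCurves.FunctionFieldPlacesGenusProofs
import Literature.NumberTheory.EllipticCurves.ZetaEllipticCurveFiniteFieldProofs
import Literature.NumberTheory.DiophantineGeometry.FunctionFieldZetaProofs
import Literature.NumberTheory.DiophantineGeometry.FunctionFieldZetaRationalityProofs
import HarnessLib

/-!
# `L(E, s)` over a global function field: analytic continuation from the two deep leaves

Topic `NumberTheory/EllipticCurves`. A theorems-only assembly file (D-0014) for the provefact
decomposition of `Literature.NumberTheory.EllipticCurves.FunctionField.HasLContinuation` / `hasLContinuation_of_functionField`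
(Ulmer 2011, Lecture 1, §9: "in all cases `L(E, s)` is holomorphic at `s = 1`"; Exercise 9.2 for
constant `E`, Theorem 9.3 for non-constant `E`).

`FunctionFieldEllipticLRationality` assembles `hasLContinuation_of_functionField Fq W` from four
named facts (`hasLContinuation_of_functionField_of_facts`: `hWeil`, `h93`, `hHW`, `h92`);
`FunctionFieldEllipticLConstantProofs` discharges `h92` (Ulmer's Exercise 9.2,
`ellLFunction_eq_div_of_isConstantCurve_holds`, giving `hasLContinuation_of_functionField_of_facts'`)
and `ZetaEllipticCurveFiniteFieldProofs` discharges `hHW` (Silverman V.2.3.1(a),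
`WeierstrassCurve.card_point_baseChange_eq_holds`). This file records the resulting two-leaf
form: the continuation of `L(E, s)` to `s = 1` for an elliptic curve over a global function field
`F` follows from

* `hWeil`: Weil's theorem for `F` over each finite constant field `k` (`existsUnique_isGenus k F`,
  or its corrected vendored form `existsUnique_isGenus_of_functionField k F` of
  `FunctionFieldPlacesGenusProofs` — the same `Prop` at a global function field: `ζ_F` in Weil
  form, Weil 1948, the Riemann hypothesis for curves over finite fields; not in Mathlib or
  Literature), and
* `h93`: Ulmer's Theorem 9.3 for non-constant `E` (`ellLFunction_eq_prod_of_not_isConstantCurve k W`: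
  `L(E, s)` is a polynomial in `q^{-s}` with inverse roots of absolute value `q`;
  Grothendieck–Deligne, étale cohomology; not in Mathlib or Literature).

Contents: `hasLContinuation_of_functionField_of_facts₂`, `hasLContinuation_of_facts₂` (the
original `Prop` of `FunctionFieldEllipticL`), `HasLContinuation.of_facts₂` (the predicate
consumed by `lFunction`/`analyticRank`/`leadingLCoeff`), and the same with the corrected genus
fact: `hasLContinuation_of_functionField_of_leaves`, `HasLContinuation.of_leaves`.
No definitions.

**Appended (provefact pass on `HasLContinuation`, gen. 1): the leaf `hWeil` resolved into textbook
theorems.** `Literature.NumberTheory.DiophantineGeometry.FunctionFieldZetaProofs` proves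
`existsUnique_isGenus_of_functionField k F` from the two named facts of `FunctionFieldZeta` —
Stichtenoth Thm. 5.1.15 (a) (`AlgFunctionField.lSeries_eq_polynomial`: `L(t) = (1-t)(1-qt)Z(t)` is
a polynomial of degree `2g`, F. K. Schmidt; over the Riemann–Roch genus, with Riemann–Roch itself
proved in the tree, `FunctionFieldAdelesProofs.riemann_roch_holds`) and Thm. 5.2.1
(`AlgFunctionField.hasseWeil`, the Riemann hypothesis for curves, Weil 1948) — via the Euler
product `t Z'/Z = ∑ N_r t^r` (Prop. 5.1.8, proved) and Cor. 5.1.16 (proved). Hence the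
three-leaf forms `hasLContinuation_of_functionField_of_zeta_leaves`, `HasLContinuation.of_zeta_leaves`:
the continuation of `L(E, s)` to `s = 1` for an elliptic curve over a global function field
follows from Stichtenoth Thm. 5.1.15 (a), Thm. 5.2.1 (for `F` over each finite constant field with
a compatible algebra structure) and Ulmer's Theorem 9.3 (`h93`, Grothendieck–Deligne).

**Appended (same pass): Thm. 5.1.15 (a) resolved into F. K. Schmidt's `∂ = 1`.**
`Literature.NumberTheory.DiophantineGeometry.FunctionFieldZetaRationalityProofs` proves
`lSeries_eq_polynomial k F` from `minPosDegree k F = 1` (Stichtenoth Cor. 5.1.11, F. K. Schmidt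
1931: a divisor of degree one exists) using the Riemann–Roch theorem and Lemma 5.1.4, both proved
in the tree. Hence `hasLContinuation_of_functionField_of_schmidt_leaves`,
`HasLContinuation.of_schmidt_leaves`: the continuation of `L(E, s)` follows from `∂ = 1` and
Thm. 5.2.1 for `F` over each finite full constant field, and Ulmer's Theorem 9.3.

## References

* [Ulmer2011ParkCity] D. Ulmer, *Elliptic curves over function fields*, IAS/Park City Math.
  Ser. 18 (2011), Lecture 1, §9, Theorem 9.3 and Exercise 9.2 (arXiv:1101.1939, p. 18).
* [Weil1948] A. Weil, *Sur les courbes algébriques et les variétés qui s'en déduisent*,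
  Hermann 1948.
* [SilvermanAEC2009] J. H. Silverman, *The Arithmetic of Elliptic Curves*, 2nd ed., Thm. V.2.3.1.
* [Stichtenoth2009] H. Stichtenoth, *Algebraic Function Fields and Codes*, 2nd ed., GTM 254,
  Thm. 5.1.15 (a), Cor. 5.1.16, Thm. 5.2.1.
-/

noncomputable section

namespace Literature.NumberTheory.EllipticCurves.FunctionField

-- `_root_`: the import closure now contains the namespace
-- `Literature.NumberTheory.EllipticCurves.FunctionField.Polynomial` (`FunctionFieldPlacesProofs`),
-- which a bare `open scoped Polynomial` would pick up here (CONVENTIONS §2).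
open scoped _root_.Polynomial

variable {F : Type} [Field F]
variable (Fq : Type) [Field Fq] [Fintype Fq]
variable [Algebra Fq[X] F] [Algebra (RatFunc Fq) F] [IsScalarTower Fq[X] (RatFunc Fq) F]
  [FunctionField Fq F]

/-- **`hasLContinuation_of_functionField` from two leaves.** With Ulmer's Exercise 9.2
(`ellLFunction_eq_div_of_isConstantCurve_holds`, `FunctionFieldEllipticLConstantProofs`) and
Hasse–Weil for elliptic curves over finite fields (`WeierstrassCurve.card_point_baseChange_eq_holds`,
`ZetaEllipticCurveFiniteFieldProofs`) discharged, the analytic continuation of `L(E, s)` to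
`s = 1` for an elliptic curve over a global function field `F` follows from exactly two named
facts, each quantified over the finite constant fields `k` of `F`: Weil's theorem for `F`
(`existsUnique_isGenus k F`: rationality and Riemann hypothesis of `ζ_F`, Weil 1948) and
Ulmer's Theorem 9.3 for non-constant `E` (`ellLFunction_eq_prod_of_not_isConstantCurve k W`:
Grothendieck–Deligne). Relies on: hypotheses `hWeil`, `h93` (named facts).
[cite: Ulmer2011ParkCity, Lect. 1, §9, Thm. 9.3 and Exercise 9.2] -/
theorem hasLContinuation_of_functionField_of_facts₂ (W : WeierstrassCurve F)
    (hWeil : ∀ (k : Type) [Field k] [Fintype k] [Algebra k[X] F] [Algebra (RatFunc k) F]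
      [IsScalarTower k[X] (RatFunc k) F] [FunctionField k F], existsUnique_isGenus k F)
    (h93 : ∀ (k : Type) [Field k] [Fintype k] [Algebra k[X] F] [Algebra (RatFunc k) F]
      [IsScalarTower k[X] (RatFunc k) F] [FunctionField k F],
      ellLFunction_eq_prod_of_not_isConstantCurve k W) :
    hasLContinuation_of_functionField Fq W :=
  hasLContinuation_of_functionField_of_facts' Fq W hWeil h93
    fun _ _ _ W₀ => WeierstrassCurve.card_point_baseChange_eq_holds W₀

include Fq in
/-- The same for the original `Prop` `hasLContinuation W` of `FunctionFieldEllipticL`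
(definitionally equal at a global function field). Relies on: hypotheses `hWeil`, `h93`
(named facts). [cite: Ulmer2011ParkCity, Lect. 1, §9, Thm. 9.3 and Exercise 9.2] -/
theorem hasLContinuation_of_facts₂ (W : WeierstrassCurve F)
    (hWeil : ∀ (k : Type) [Field k] [Fintype k] [Algebra k[X] F] [Algebra (RatFunc k) F]
      [IsScalarTower k[X] (RatFunc k) F] [FunctionField k F], existsUnique_isGenus k F)
    (h93 : ∀ (k : Type) [Field k] [Fintype k] [Algebra k[X] F] [Algebra (RatFunc k) F]
      [IsScalarTower k[X] (RatFunc k) F] [FunctionField k F],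
      ellLFunction_eq_prod_of_not_isConstantCurve k W) :
    hasLContinuation W :=
  hasLContinuation_of_hasLContinuation_of_functionField Fq W
    (hasLContinuation_of_functionField_of_facts₂ Fq W hWeil h93)

include Fq in
/-- The predicate `HasLContinuation W` of `FunctionFieldEllipticL` (the hypothesis under which
`lFunction W`, `analyticRank W` and `leadingLCoeff W` are the genuine continuation data) for an
elliptic curve over a global function field, from the two leaves `hWeil`, `h93`.
Relies on: hypotheses `hWeil`, `h93` (named facts).
[cite: Ulmer2011ParkCity, Lect. 1, §9, Thm. 9.3 and Exercise 9.2] -/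
theorem HasLContinuation.of_facts₂ (W : WeierstrassCurve F) [W.IsElliptic]
    (hWeil : ∀ (k : Type) [Field k] [Fintype k] [Algebra k[X] F] [Algebra (RatFunc k) F]
      [IsScalarTower k[X] (RatFunc k) F] [FunctionField k F], existsUnique_isGenus k F)
    (h93 : ∀ (k : Type) [Field k] [Fintype k] [Algebra k[X] F] [Algebra (RatFunc k) F]
      [IsScalarTower k[X] (RatFunc k) F] [FunctionField k F],
      ellLFunction_eq_prod_of_not_isConstantCurve k W) :
    HasLContinuation W :=
  hasLContinuation_of_facts₂ Fq W hWeil h93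

/-- **The two deep leaves, in corrected form.** `hasLContinuation_of_functionField Fq W` from
Weil's theorem for `F` in its corrected vendored form `existsUnique_isGenus_of_functionField k F`
(`FunctionFieldPlacesGenusProofs`; the same `Prop` as `existsUnique_isGenus k F` at a global
function field, `existsUnique_isGenus_of_functionField_iff`) and Ulmer's Theorem 9.3
(`ellLFunction_eq_prod_of_not_isConstantCurve k W`), each over every finite constant field `k`
of `F`. Relies on: hypotheses `hWeil`, `h93` (named facts, both open in the tree: the Riemann
hypothesis for curves over finite fields, resp. Grothendieck–Deligne).
[cite: Ulmer2011ParkCity, Lect. 1, §9, Thm. 9.3 and Exercise 9.2] -/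
theorem hasLContinuation_of_functionField_of_leaves (W : WeierstrassCurve F)
    (hWeil : ∀ (k : Type) [Field k] [Fintype k] [Algebra k[X] F] [Algebra (RatFunc k) F]
      [IsScalarTower k[X] (RatFunc k) F] [FunctionField k F],
      existsUnique_isGenus_of_functionField k F)
    (h93 : ∀ (k : Type) [Field k] [Fintype k] [Algebra k[X] F] [Algebra (RatFunc k) F]
      [IsScalarTower k[X] (RatFunc k) F] [FunctionField k F],
      ellLFunction_eq_prod_of_not_isConstantCurve k W) :
    hasLContinuation_of_functionField Fq W :=
  hasLContinuation_of_functionField_of_facts₂ Fq W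
    (fun k _ _ _ _ _ _ => (existsUnique_isGenus_of_functionField_iff k F).mp (hWeil k)) h93

include Fq in
/-- `HasLContinuation W` for an elliptic curve over a global function field from the two leaves
in corrected form. Relies on: hypotheses `hWeil`, `h93` (named facts).
[cite: Ulmer2011ParkCity, Lect. 1, §9, Thm. 9.3 and Exercise 9.2] -/
theorem HasLContinuation.of_leaves (W : WeierstrassCurve F) [W.IsElliptic]
    (hWeil : ∀ (k : Type) [Field k] [Fintype k] [Algebra k[X] F] [Algebra (RatFunc k) F]
      [IsScalarTower k[X] (RatFunc k) F] [FunctionField k F],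
      existsUnique_isGenus_of_functionField k F)
    (h93 : ∀ (k : Type) [Field k] [Fintype k] [Algebra k[X] F] [Algebra (RatFunc k) F]
      [IsScalarTower k[X] (RatFunc k) F] [FunctionField k F],
      ellLFunction_eq_prod_of_not_isConstantCurve k W) :
    HasLContinuation W :=
  hasLContinuation_of_hasLContinuation_of_functionField Fq W
    (hasLContinuation_of_functionField_of_leaves Fq W hWeil h93)

/-! ### Appended: the leaf `hWeil` from Stichtenoth Thm. 5.1.15 (a) and Thm. 5.2.1 -/

/-- **`hasLContinuation_of_functionField` from three textbook leaves.** For an elliptic curve over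
a global function field `F`, the continuation of `L(E, s)` to `ℂ`, holomorphic at `s = 1`
(Ulmer 2011, Lecture 1, §9), follows from: for every finite constant field `k` of `F` with a
compatible `k`-algebra structure, Stichtenoth Thm. 5.1.15 (a) (`lSeries_eq_polynomial k F`,
rationality of `ζ_F` with `deg L = 2g`) and Thm. 5.2.1 (`hasseWeil k F`, the Riemann hypothesis
for `F/k`); and Ulmer's Theorem 9.3 for non-constant `E` (`h93`). The genus leaf is supplied by
`existsUnique_isGenus_of_functionField_of_zeta_facts` (`FunctionFieldZetaProofs`) at the algebra
structure `k → k[X] → F`. Relies on: hypotheses `hL`, `hHW`, `h93` (named facts, open in the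
tree: F. K. Schmidt's theorem needs constant field extensions, Thm. 5.2.1 is Bombieri–Stepanov,
Thm. 9.3 is Grothendieck–Deligne).
[cite: Ulmer2011ParkCity, Lect. 1, §9, Thm. 9.3 and Exercise 9.2]
[cite: Stichtenoth2009, Thm. 5.1.15(a) and Thm. 5.2.1] -/
theorem hasLContinuation_of_functionField_of_zeta_leaves (W : WeierstrassCurve F)
    (hL : ∀ (k : Type) [Field k] [Fintype k] [Algebra k[X] F] [Algebra (RatFunc k) F]
      [IsScalarTower k[X] (RatFunc k) F] [FunctionField k F] [Algebra k F] [IsScalarTower k k[X] F],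
      DiophantineGeometry.AlgFunctionField.lSeries_eq_polynomial k F)
    (hHW : ∀ (k : Type) [Field k] [Fintype k] [Algebra k[X] F] [Algebra (RatFunc k) F]
      [IsScalarTower k[X] (RatFunc k) F] [FunctionField k F] [Algebra k F] [IsScalarTower k k[X] F],
      DiophantineGeometry.AlgFunctionField.hasseWeil k F)
    (h93 : ∀ (k : Type) [Field k] [Fintype k] [Algebra k[X] F] [Algebra (RatFunc k) F]
      [IsScalarTower k[X] (RatFunc k) F] [FunctionField k F],
      ellLFunction_eq_prod_of_not_isConstantCurve k W) :
    hasLContinuation_of_functionField Fq W := by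
  refine hasLContinuation_of_functionField_of_leaves Fq W (fun k _ _ _ _ _ _ => ?_) h93
  letI : Algebra k F := ((algebraMap k[X] F).comp Polynomial.C).toAlgebra
  haveI : IsScalarTower k k[X] F := IsScalarTower.of_algebraMap_eq fun c => by
    rw [RingHom.algebraMap_toAlgebra, RingHom.comp_apply, Polynomial.C_eq_algebraMap]
  exact existsUnique_isGenus_of_functionField_of_zeta_facts k F (hL k) (hHW k)

include Fq in
/-- The predicate `HasLContinuation W` of `FunctionFieldEllipticL` (under which `lFunction W`,
`analyticRank W`, `leadingLCoeff W` are the genuine continuation data) for an elliptic curve over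
a global function field, from the three textbook leaves: Stichtenoth Thm. 5.1.15 (a) and
Thm. 5.2.1 for `F` over its finite constant fields, and Ulmer's Theorem 9.3. Relies on:
hypotheses `hL`, `hHW`, `h93` (named facts).
[cite: Ulmer2011ParkCity, Lect. 1, §9, Thm. 9.3 and Exercise 9.2]
[cite: Stichtenoth2009, Thm. 5.1.15(a) and Thm. 5.2.1] -/
theorem HasLContinuation.of_zeta_leaves (W : WeierstrassCurve F) [W.IsElliptic]
    (hL : ∀ (k : Type) [Field k] [Fintype k] [Algebra k[X] F] [Algebra (RatFunc k) F]
      [IsScalarTower k[X] (RatFunc k) F] [FunctionField k F] [Algebra k F] [IsScalarTower k k[X] F],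
      DiophantineGeometry.AlgFunctionField.lSeries_eq_polynomial k F)
    (hHW : ∀ (k : Type) [Field k] [Fintype k] [Algebra k[X] F] [Algebra (RatFunc k) F]
      [IsScalarTower k[X] (RatFunc k) F] [FunctionField k F] [Algebra k F] [IsScalarTower k k[X] F],
      DiophantineGeometry.AlgFunctionField.hasseWeil k F)
    (h93 : ∀ (k : Type) [Field k] [Fintype k] [Algebra k[X] F] [Algebra (RatFunc k) F]
      [IsScalarTower k[X] (RatFunc k) F] [FunctionField k F],
      ellLFunction_eq_prod_of_not_isConstantCurve k W) :
    HasLContinuation W :=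
  hasLContinuation_of_hasLContinuation_of_functionField Fq W
    (hasLContinuation_of_functionField_of_zeta_leaves Fq W hL hHW h93)

/-! ### Appended: the leaf Thm. 5.1.15 (a) from F. K. Schmidt's theorem `∂ = 1` -/

/-- **`hasLContinuation_of_functionField` from F. K. Schmidt's theorem, the Hasse–Weil theorem and
Ulmer's Theorem 9.3.** For an elliptic curve over a global function field `F`, the continuation of
`L(E, s)` to `ℂ`, holomorphic at `s = 1` (Ulmer 2011, Lecture 1, §9), follows from: for every finite
constant field `k` of `F` with a compatible `k`-algebra structure for which `k` is the full constant
field, the existence of a divisor of degree one (`minPosDegree k F = 1`, Stichtenoth Cor. 5.1.11 —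
F. K. Schmidt 1931) and the Hasse–Weil theorem (`hasseWeil k F`, Thm. 5.2.1); and Ulmer's
Theorem 9.3 for non-constant `E` (`h93`). Thm. 5.1.15 (a) is supplied by
`lSeries_eq_polynomial_of_minPosDegree_eq_one` (`FunctionFieldZetaRationalityProofs`: Riemann–Roch
and Lemma 5.1.4, proved in the tree). Relies on: hypotheses `hd`, `hHW`, `h93` (open in the tree:
constant field extensions, Bombieri–Stepanov, Grothendieck–Deligne respectively).
[cite: Ulmer2011ParkCity, Lect. 1, §9, Thm. 9.3 and Exercise 9.2]
[cite: Stichtenoth2009, Cor. 5.1.11 and Thm. 5.2.1] -/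
theorem hasLContinuation_of_functionField_of_schmidt_leaves (W : WeierstrassCurve F)
    (hd : ∀ (k : Type) [Field k] [Fintype k] [Algebra k[X] F] [Algebra (RatFunc k) F]
      [IsScalarTower k[X] (RatFunc k) F] [FunctionField k F] [Algebra k F] [IsScalarTower k k[X] F]
      [DiophantineGeometry.IsAlgFunctionField k F] [IsIntegrallyClosedIn k F],
      DiophantineGeometry.AlgFunctionField.minPosDegree k F = 1)
    (hHW : ∀ (k : Type) [Field k] [Fintype k] [Algebra k[X] F] [Algebra (RatFunc k) F]
      [IsScalarTower k[X] (RatFunc k) F] [FunctionField k F] [Algebra k F] [IsScalarTower k k[X] F],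
      DiophantineGeometry.AlgFunctionField.hasseWeil k F)
    (h93 : ∀ (k : Type) [Field k] [Fintype k] [Algebra k[X] F] [Algebra (RatFunc k) F]
      [IsScalarTower k[X] (RatFunc k) F] [FunctionField k F],
      ellLFunction_eq_prod_of_not_isConstantCurve k W) :
    hasLContinuation_of_functionField Fq W := by
  refine hasLContinuation_of_functionField_of_zeta_leaves Fq W (fun k _ _ _ _ _ _ _ _ => ?_) hHW h93
  intro _ _
  exact DiophantineGeometry.AlgFunctionField.lSeries_eq_polynomial_of_minPosDegree_eq_one (hd k)

include Fq in
/-- The predicate `HasLContinuation W` of `FunctionFieldEllipticL` for an elliptic curve over a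
global function field from the three leaves: F. K. Schmidt's `∂ = 1` and the Hasse–Weil theorem for
`F` over its finite full constant fields, and Ulmer's Theorem 9.3. Relies on: hypotheses `hd`,
`hHW`, `h93` (named facts / open hypotheses).
[cite: Ulmer2011ParkCity, Lect. 1, §9, Thm. 9.3 and Exercise 9.2]
[cite: Stichtenoth2009, Cor. 5.1.11 and Thm. 5.2.1] -/
theorem HasLContinuation.of_schmidt_leaves (W : WeierstrassCurve F) [W.IsElliptic]
    (hd : ∀ (k : Type) [Field k] [Fintype k] [Algebra k[X] F] [Algebra (RatFunc k) F]
      [IsScalarTower k[X] (RatFunc k) F] [FunctionField k F] [Algebra k F] [IsScalarTower k k[X] F]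
      [DiophantineGeometry.IsAlgFunctionField k F] [IsIntegrallyClosedIn k F],
      DiophantineGeometry.AlgFunctionField.minPosDegree k F = 1)
    (hHW : ∀ (k : Type) [Field k] [Fintype k] [Algebra k[X] F] [Algebra (RatFunc k) F]
      [IsScalarTower k[X] (RatFunc k) F] [FunctionField k F] [Algebra k F] [IsScalarTower k k[X] F],
      DiophantineGeometry.AlgFunctionField.hasseWeil k F)
    (h93 : ∀ (k : Type) [Field k] [Fintype k] [Algebra k[X] F] [Algebra (RatFunc k) F]
      [IsScalarTower k[X] (RatFunc k) F] [FunctionField k F],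
      ellLFunction_eq_prod_of_not_isConstantCurve k W) :
    HasLContinuation W :=
  hasLContinuation_of_hasLContinuation_of_functionField Fq W
    (hasLContinuation_of_functionField_of_schmidt_leaves Fq W hd hHW h93)

end Literature.NumberTheory.EllipticCurves.FunctionField

end
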